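import Summits.Ventures.PercRepro.K4LadderBase

/-!
# PercRepro — C-025 on `T_p(M(K₄) ⊕ U_{m,m})`: the arithmetic of the layer BELOW the first active one (p9, gen 14)

`proofs/P9-S4-LINELADDER-g13.md` §8 ADDENDUM (v7), the layer `m = p + q − 4` (corank `q + 2`: the window map's
minimiser layer for the block `M(K₄)`). There the orbits `(0,3)` and `(3,0)` are inactive, so with `c_a = C(m, a)`

  `#U = 37·c_{q−3} + 19·c_{q−2} + 6·c_{q−1}`,   `#Y = A + 6B + 19C + 38D` (the partial row sums of `K4LadderBase`),

`Φ(p,q)` is the Pascal FOURTH power `(A + 4B + 6C + 4D + E) / (c_{q−4} + 4c_{q−3} + 6c_{q−2} + 4c_{q−1} + c_q)`,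
the reflection gives `A = E`, `B = D`, `B + c_{q−3} = A + c_q`, `C + c_{q−2} = B + c_{q−1}`, and the cross-multiplied
inequality is `A·(64Q − 16P) + (63c₀ + 19c₁ − 19c₂ − 63c₃)Q − (14c₀ + 6c₁ − 6c₂ − 14c₃)P` with `A ≥ c₃`,
`64Q − 16P = c₄·(15 positive monomials)/((r+1)(r+2)(r+3)(r+4))` and the rest `= c₄²·H(s,r)/((r+1)(r+2)(r+3)(r+4))²`,
`H` a polynomial with 45 positive monomials (`q = r + 4`, `p = r + s + 6`). No `m`-induction: the layer is a single `m`
for each `(p, q)`. The general Pascal lemma `sum_choose_add` (Vandermonde on partial row sums) replaces the hand-rolled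
cube of `K4LadderBase`. No matroid is mentioned (the bridge is `K4LadderLowerBridge`); nothing about any window of S4.
-/

namespace PercRepro.LineLadder

open Finset

/-- **Pascal iterated** (Vandermonde on partial row sums): for `k ≤ s`,
`Σ_{a ∈ [s, t)} C(m + k, a) = Σ_{i ≤ k} C(k, i) · Σ_{a ∈ [s − i, t − i)} C(m, a)`. -/
lemma sum_choose_add (m : ℕ) : ∀ (k s t : ℕ), k ≤ s →
    ∑ a ∈ Ico s t, (m + k).choose a = ∑ i ∈ range (k + 1), k.choose i * ∑ a ∈ Ico (s - i) (t - i), m.choose a := by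
  intro k
  induction k with
  | zero => intro s t _; simp
  | succ k ih =>
    intro s t hs
    rw [← Nat.add_assoc, sum_choose_succ' (m + k) s t (by omega), ih s t (by omega), ih (s - 1) (t - 1) (by omega)]
    have hY : ∑ i ∈ range (k + 1), k.choose i * ∑ a ∈ Ico (s - 1 - i) (t - 1 - i), m.choose a
        = ∑ i ∈ range (k + 1), k.choose i * ∑ a ∈ Ico (s - (i + 1)) (t - (i + 1)), m.choose a :=
      Finset.sum_congr rfl fun i _ => by
        rw [show s - 1 - i = s - (i + 1) by omega, show t - 1 - i = t - (i + 1) by omega]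
    have hX : ∑ i ∈ range (k + 1), k.choose i * ∑ a ∈ Ico (s - i) (t - i), m.choose a
        = ∑ i ∈ range (k + 1), k.choose (i + 1) * ∑ a ∈ Ico (s - (i + 1)) (t - (i + 1)), m.choose a
          + ∑ a ∈ Ico s t, m.choose a := by
      have h1 := Finset.sum_range_succ' (fun i => k.choose i * ∑ a ∈ Ico (s - i) (t - i), m.choose a) (k + 1)
      have h2 := Finset.sum_range_succ (fun i => k.choose i * ∑ a ∈ Ico (s - i) (t - i), m.choose a) (k + 1)
      rw [h2] at h1
      simp only [Nat.choose_succ_self, Nat.zero_mul, Nat.add_zero, Nat.choose_zero_right, Nat.one_mul,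
        Nat.sub_zero] at h1
      exact h1
    have hR : ∑ i ∈ range (k + 1 + 1), (k + 1).choose i * ∑ a ∈ Ico (s - i) (t - i), m.choose a
        = ∑ i ∈ range (k + 1), k.choose i * ∑ a ∈ Ico (s - (i + 1)) (t - (i + 1)), m.choose a
          + ∑ i ∈ range (k + 1), k.choose (i + 1) * ∑ a ∈ Ico (s - (i + 1)) (t - (i + 1)), m.choose a
          + ∑ a ∈ Ico s t, m.choose a := by
      rw [Finset.sum_range_succ' (fun i => (k + 1).choose i * ∑ a ∈ Ico (s - i) (t - i), m.choose a) (k + 1),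
        ← Finset.sum_add_distrib]
      simp only [Nat.choose_zero_right, Nat.one_mul, Nat.sub_zero]
      congr 1
      refine Finset.sum_congr rfl fun i _ => ?_
      rw [Nat.choose_succ_succ', Nat.add_mul, Nat.add_comm]
    rw [hX, hY, hR]
    ring

/-- The Pascal fourth power for the numerator of `Φ` at the layer `K = p + q − 4` (`q = r + 4`, `p = r + s + 6`):
`Σ_{q<u<p} C(K+4, u) = A + 4B + 6C + 4D + E`. -/
lemma k4l_num_eq (r s : ℕ) :
    ∑ u ∈ Ioo (r + 4) (r + s + 6), (2 * r + s + 6 + 4).choose u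
      = ∑ a ∈ Ico (r + 5) (r + s + 6), (2 * r + s + 6).choose a
        + 4 * ∑ a ∈ Ico (r + 4) (r + s + 5), (2 * r + s + 6).choose a
        + 6 * ∑ a ∈ Ico (r + 3) (r + s + 4), (2 * r + s + 6).choose a
        + 4 * ∑ a ∈ Ico (r + 2) (r + s + 3), (2 * r + s + 6).choose a
        + ∑ a ∈ Ico (r + 1) (r + s + 2), (2 * r + s + 6).choose a := by
  rw [Ioo_eq_Ico', sum_choose_add (2 * r + s + 6) 4 (r + 4 + 1) (r + s + 6) (by omega)]
  simp only [Finset.sum_range_succ, Finset.sum_range_zero, Nat.choose_zero_right, Nat.choose_one_right,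
    Nat.choose_self, show Nat.choose 4 2 = 6 from rfl, show Nat.choose 4 3 = 4 from rfl, Nat.sub_zero,
    show r + 4 + 1 = r + 5 from rfl, show r + 5 - 1 = r + 4 by omega, show r + s + 6 - 1 = r + s + 5 by omega,
    show r + 5 - 2 = r + 3 by omega, show r + s + 6 - 2 = r + s + 4 by omega, show r + 5 - 3 = r + 2 by omega,
    show r + s + 6 - 3 = r + s + 3 by omega, show r + 5 - 4 = r + 1 by omega, show r + s + 6 - 4 = r + s + 2 by omega]
  ring

/-- The Pascal fourth power for the denominator of `Φ` at the layer `K = p + q − 4`: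
`C(K+4, p) = c_{q−4} + 4c_{q−3} + 6c_{q−2} + 4c_{q−1} + c_q`. -/
lemma k4l_den_eq (r s : ℕ) :
    (2 * r + s + 6 + 4).choose (r + s + 6)
      = (2 * r + s + 6).choose r + 4 * (2 * r + s + 6).choose (r + 1) + 6 * (2 * r + s + 6).choose (r + 2)
        + 4 * (2 * r + s + 6).choose (r + 3) + (2 * r + s + 6).choose (r + 4) := by
  have h := sum_choose_add (2 * r + s + 6) 4 (r + s + 6) (r + s + 6 + 1) (by omega)
  rw [Nat.Ico_succ_singleton, Finset.sum_singleton] at h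
  rw [h]
  simp only [Finset.sum_range_succ, Finset.sum_range_zero, Nat.choose_zero_right, Nat.choose_one_right,
    Nat.choose_self, show Nat.choose 4 2 = 6 from rfl, show Nat.choose 4 3 = 4 from rfl, Nat.sub_zero,
    show r + s + 6 + 1 - 1 = r + s + 6 by omega, show r + s + 6 - 1 = r + s + 5 by omega,
    show r + s + 6 + 1 - 2 = r + s + 5 by omega, show r + s + 6 - 2 = r + s + 4 by omega,
    show r + s + 6 + 1 - 3 = r + s + 4 by omega, show r + s + 6 - 3 = r + s + 3 by omega,
    show r + s + 6 + 1 - 4 = r + s + 3 by omega, show r + s + 6 - 4 = r + s + 2 by omega,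
    Nat.Ico_succ_singleton, Finset.sum_singleton]
  have e0 : (2 * r + s + 6).choose (r + s + 6) = (2 * r + s + 6).choose r := by
    rw [← Nat.choose_symm (show r ≤ 2 * r + s + 6 by omega), show 2 * r + s + 6 - r = r + s + 6 by omega]
  have e1 : (2 * r + s + 6).choose (r + s + 5) = (2 * r + s + 6).choose (r + 1) := by
    rw [← Nat.choose_symm (show r + 1 ≤ 2 * r + s + 6 by omega), show 2 * r + s + 6 - (r + 1) = r + s + 5 by omega]
  have e2 : (2 * r + s + 6).choose (r + s + 4) = (2 * r + s + 6).choose (r + 2) := by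
    rw [← Nat.choose_symm (show r + 2 ≤ 2 * r + s + 6 by omega), show 2 * r + s + 6 - (r + 2) = r + s + 4 by omega]
  have e3 : (2 * r + s + 6).choose (r + s + 3) = (2 * r + s + 6).choose (r + 3) := by
    rw [← Nat.choose_symm (show r + 3 ≤ 2 * r + s + 6 by omega), show 2 * r + s + 6 - (r + 3) = r + s + 3 by omega]
  have e4 : (2 * r + s + 6).choose (r + s + 2) = (2 * r + s + 6).choose (r + 4) := by
    rw [← Nat.choose_symm (show r + 4 ≤ 2 * r + s + 6 by omega), show 2 * r + s + 6 - (r + 4) = r + s + 2 by omega]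
  rw [e0, e1, e2, e3, e4]
  ring


/-- The coefficient of `A` at the lower layer: `64Q − 16P = c₄·(15 positive monomials)/((r+1)(r+2)(r+3)(r+4))`. -/
lemma lower_coef_key (r s : ℕ) (c0 c1 c2 c3 c4 : ℚ)
    (qr3 : c3 = c4 * (r + s + 6) / (r + 1)) (qr2 : c2 = c3 * (r + s + 5) / (r + 2))
    (qr1 : c1 = c2 * (r + s + 4) / (r + 3)) (qr0 : c0 = c1 * (r + s + 3) / (r + 4)) :
    64 * (c4 + 4 * c3 + 6 * c2 + 4 * c1 + c0) - 16 * (37 * c3 + 19 * c2 + 6 * c1)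
      = c4 * ((81792 + 58528 * (r : ℚ) + 13936 * (r : ℚ)^2 + 1232 * (r : ℚ)^3 + 32 * (r : ℚ)^4 + 71744 * (s : ℚ) + 45616 * (s : ℚ) * (r : ℚ) + 9152 * (s : ℚ) * (r : ℚ)^2 + 560 * (s : ℚ) * (r : ℚ)^3 + 18176 * (s : ℚ)^2 + 8336 * (s : ℚ)^2 * (r : ℚ) + 944 * (s : ℚ)^2 * (r : ℚ)^2 + 1792 * (s : ℚ)^3 + 416 * (s : ℚ)^3 * (r : ℚ) + 64 * (s : ℚ)^4) / (((r : ℚ) + 1) * (r + 2) * (r + 3) * (r + 4))) := by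
  rw [qr0, qr1, qr2, qr3]
  field_simp
  ring

/-- The rest at the lower layer: `c₃·(64Q − 16P) + (…)Q − (…)P = c₄²·H(s,r)/((r+1)(r+2)(r+3)(r+4))²`, `H` the polynomial
with 45 positive monomials of P9-S4-LINELADDER-g13.md §8 ADDENDUM (v7). -/
lemma lower_rest_key (r s : ℕ) (c0 c1 c2 c3 c4 : ℚ)
    (qr3 : c3 = c4 * (r + s + 6) / (r + 1)) (qr2 : c2 = c3 * (r + s + 5) / (r + 2))
    (qr1 : c1 = c2 * (r + s + 4) / (r + 3)) (qr0 : c0 = c1 * (r + s + 3) / (r + 4)) :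
    c3 * (64 * (c4 + 4 * c3 + 6 * c2 + 4 * c1 + c0) - 16 * (37 * c3 + 19 * c2 + 6 * c1))
        + (63 * c0 + 19 * c1 - 19 * c2 - 63 * c3) * (c4 + 4 * c3 + 6 * c2 + 4 * c1 + c0)
        - (14 * c0 + 6 * c1 - 6 * c2 - 14 * c3) * (37 * c3 + 19 * c2 + 6 * c1)
      = c4 ^ 2 * ((35513856 + 58963584 * (r : ℚ) + 41776736 * (r : ℚ)^2 + 16419096 * (r : ℚ)^3 + 3887812 * (r : ℚ)^4 + 561756 * (r : ℚ)^5 + 47464 * (r : ℚ)^6 + 2064 * (r : ℚ)^7 + 32 * (r : ℚ)^8 + 66158880 * (s : ℚ) + 99098952 * (s : ℚ) * (r : ℚ) + 62630840 * (s : ℚ) * (r : ℚ)^2 + 21628550 * (s : ℚ) * (r : ℚ)^3 + 4403034 * (s : ℚ) * (r : ℚ)^4 + 527804 * (s : ℚ) * (r : ℚ)^5 + 34456 * (s : ℚ) * (r : ℚ)^6 + 944 * (s : ℚ) * (r : ℚ)^7 + 49732132 * (s : ℚ)^2 + 65061378 * (s : ℚ)^2 * (r : ℚ) + 35014102 * (s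 : ℚ)^2 * (r : ℚ)^2 + 9919506 * (s : ℚ)^2 * (r : ℚ)^3 + 1560070 * (s : ℚ)^2 * (r : ℚ)^4 + 129164 * (s : ℚ)^2 * (r : ℚ)^5 + 4400 * (s : ℚ)^2 * (r : ℚ)^6 + 20064280 * (s : ℚ)^3 + 22199671 * (s : ℚ)^3 * (r : ℚ) + 9710948 * (s : ℚ)^3 * (r : ℚ)^2 + 2098614 * (s : ℚ)^3 * (r : ℚ)^3 + 224022 * (s : ℚ)^3 * (r : ℚ)^4 + 9452 * (s : ℚ)^3 * (r : ℚ)^5 + 4800391 * (s : ℚ)^4 + 4303968 * (s : ℚ)^4 * (r : ℚ) + 1431708 * (s : ℚ)^4 * (r : ℚ)^2 + 209278 * (s : ℚ)^4 * (r : ℚ)^3 + 11334 * (s : ℚ)^4 * (r : ℚ)^4 + 702592 * (s : ℚ)^5 + 477646 * (s : ℚ)^5 * (r : ℚ) + 107260 * (s : ℚ)^5 * (r : ℚ)^2 + 7948 * (s : ℚ)^5 * (r : ℚ)^3 + 61846 * (s : ℚ)^6 + 28254 * (s : ℚ)^6 * (r : ℚ) + 3206 * (s : ℚ)^6 * (r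 : ℚ)^2 + 3016 * (s : ℚ)^7 + 691 * (s : ℚ)^7 * (r : ℚ) + 63 * (s : ℚ)^8) / (((r : ℚ) + 1) * (r + 2) * (r + 3) * (r + 4)) ^ 2) := by
  rw [qr0, qr1, qr2, qr3]
  field_simp
  ring

/-- The cross-multiplied inequality at the lower layer from the two nonnegative pieces (`B = A + c₀ − c₃`,
`C = B + c₁ − c₂`, `D = B`, `E = A` substituted). -/
lemma lower_final (A c0 c1 c2 c3 c4 : ℚ) (hA : c3 ≤ A)
    (hcoef : 0 ≤ 64 * (c4 + 4 * c3 + 6 * c2 + 4 * c1 + c0) - 16 * (37 * c3 + 19 * c2 + 6 * c1))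
    (hH : 0 ≤ c3 * (64 * (c4 + 4 * c3 + 6 * c2 + 4 * c1 + c0) - 16 * (37 * c3 + 19 * c2 + 6 * c1))
        + (63 * c0 + 19 * c1 - 19 * c2 - 63 * c3) * (c4 + 4 * c3 + 6 * c2 + 4 * c1 + c0)
        - (14 * c0 + 6 * c1 - 6 * c2 - 14 * c3) * (37 * c3 + 19 * c2 + 6 * c1)) :
    (A + 4 * (A + c0 - c3) + 6 * (A + c0 - c3 + c1 - c2) + 4 * (A + c0 - c3) + A)
        * (37 * c3 + 19 * c2 + 6 * c1)
      ≤ (A + 6 * (A + c0 - c3) + 19 * (A + c0 - c3 + c1 - c2) + 38 * (A + c0 - c3))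
        * (c4 + 4 * c3 + 6 * c2 + 4 * c1 + c0) := by
  have h2 := add_nonneg hH (mul_nonneg (sub_nonneg.2 hA) hcoef)
  rw [← sub_nonneg]
  convert h2 using 2
  case e'_4 => ring
  case e'_2 => rfl

set_option maxHeartbeats 1600000 in
/-- **THE LAYER BELOW THE FIRST ACTIVE ONE** (`q = r + 4`, `p = r + s + 6`, `m = K = p + q − 4 = 2r + s + 6`, corank
`q + 2`): `Φ(p,q)·#U ≤ #Y` with `#U = 37c_{q−3} + 19c_{q−2} + 6c_{q−1}`. -/
lemma k4_lower_base (r s : ℕ) :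
    phiK (r + s + 6) (r + 4) *
        ((37 * (2 * r + s + 6).choose (r + 1) + 19 * (2 * r + s + 6).choose (r + 2)
          + 6 * (2 * r + s + 6).choose (r + 3) : ℕ) : ℚ)
      ≤ ((∑ a ∈ Ico (r + 5) (r + s + 6), (2 * r + s + 6).choose a
          + 6 * ∑ a ∈ Ico (r + 4) (r + s + 5), (2 * r + s + 6).choose a
          + 19 * ∑ a ∈ Ico (r + 3) (r + s + 4), (2 * r + s + 6).choose a
          + 38 * ∑ a ∈ Ico (r + 2) (r + s + 3), (2 * r + s + 6).choose a : ℕ) : ℚ) := by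
  set K := 2 * r + s + 6 with hK
  set A := ∑ a ∈ Ico (r + 5) (r + s + 6), K.choose a with hA
  set B := ∑ a ∈ Ico (r + 4) (r + s + 5), K.choose a with hB
  set Cc := ∑ a ∈ Ico (r + 3) (r + s + 4), K.choose a with hCc
  set D := ∑ a ∈ Ico (r + 2) (r + s + 3), K.choose a with hD
  set E := ∑ a ∈ Ico (r + 1) (r + s + 2), K.choose a with hE
  set c4 := K.choose r with hc4
  set c3 := K.choose (r + 1) with hc3
  set c2 := K.choose (r + 2) with hc2
  set c1 := K.choose (r + 3) with hc1
  set c0 := K.choose (r + 4) with hc0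
  have hnum : ∑ u ∈ Ioo (r + 4) (r + s + 6), (K + 4).choose u = A + 4 * B + 6 * Cc + 4 * D + E := k4l_num_eq r s
  have hden : (K + 4).choose (r + s + 6) = c4 + 4 * c3 + 6 * c2 + 4 * c1 + c0 := k4l_den_eq r s
  have hphi : phiK (r + s + 6) (r + 4)
      = ((A + 4 * B + 6 * Cc + 4 * D + E : ℕ) : ℚ) / ((c4 + 4 * c3 + 6 * c2 + 4 * c1 + c0 : ℕ) : ℚ) := by
    unfold phiK
    rw [show r + s + 6 + (r + 4) = K + 4 by omega, ← hden, ← hnum, Nat.cast_sum]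
  have hAE : A = E := by
    rw [hA, hE, sum_choose_reflect K (r + 5) (r + s + 6) (by omega)]
    rw [show K + 1 - (r + s + 6) = r + 1 by omega, show K + 1 - (r + 5) = r + s + 2 by omega]
  have hBD : B = D := by
    rw [hB, hD, sum_choose_reflect K (r + 4) (r + s + 5) (by omega)]
    rw [show K + 1 - (r + s + 5) = r + 2 by omega, show K + 1 - (r + 4) = r + s + 3 by omega]
  have hsym3 : K.choose (r + s + 5) = c3 := by
    rw [hc3, ← Nat.choose_symm (show r + 1 ≤ K by omega), show K - (r + 1) = r + s + 5 by omega]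
  have hsym2 : K.choose (r + s + 4) = c2 := by
    rw [hc2, ← Nat.choose_symm (show r + 2 ≤ K by omega), show K - (r + 2) = r + s + 4 by omega]
  have hBA : B + c3 = A + c0 := by
    rw [hB, hA, Finset.sum_eq_sum_Ico_succ_bot (show r + 4 < r + s + 5 by omega),
      Finset.sum_Ico_succ_top (show r + 5 ≤ r + s + 5 by omega), hsym3, hc0]
    ring
  have hCB : Cc + c2 = B + c1 := by
    rw [hB, hCc, Finset.sum_eq_sum_Ico_succ_bot (show r + 3 < r + s + 4 by omega),
      Finset.sum_Ico_succ_top (show r + 4 ≤ r + s + 4 by omega), hsym2, hc1]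
    ring
  have hA3 : c3 ≤ A := by
    rw [hA, Finset.sum_Ico_succ_top (show r + 5 ≤ r + s + 5 by omega), hsym3]
    exact Nat.le_add_left _ _
  have hc4pos : 0 < c4 := Nat.choose_pos (by omega)
  -- the ratio identities
  have r3 : c3 * (r + 1) = c4 * (r + s + 6) := by
    have := choose_ratio K r; rwa [show K - r = r + s + 6 by omega] at this
  have r2 : c2 * (r + 2) = c3 * (r + s + 5) := by
    have := choose_ratio K (r + 1); rwa [show K - (r + 1) = r + s + 5 by omega] at this
  have r1 : c1 * (r + 3) = c2 * (r + s + 4) := by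
    have := choose_ratio K (r + 2); rwa [show K - (r + 2) = r + s + 4 by omega] at this
  have r0 : c0 * (r + 4) = c1 * (r + s + 3) := by
    have := choose_ratio K (r + 3); rwa [show K - (r + 3) = r + s + 3 by omega] at this
  -- to ℚ
  rw [hphi]
  have hpos : (0 : ℚ) < ((c4 + 4 * c3 + 6 * c2 + 4 * c1 + c0 : ℕ) : ℚ) := by
    exact_mod_cast (by omega : 0 < c4 + 4 * c3 + 6 * c2 + 4 * c1 + c0)
  rw [div_mul_eq_mul_div, div_le_iff₀ hpos]
  have qAE : (A : ℚ) = E := by exact_mod_cast hAE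
  have qBD : (B : ℚ) = D := by exact_mod_cast hBD
  have qBA : (B : ℚ) + c3 = A + c0 := by exact_mod_cast hBA
  have qCB : (Cc : ℚ) + c2 = B + c1 := by exact_mod_cast hCB
  have qA3 : (c3 : ℚ) ≤ A := by exact_mod_cast hA3
  have qr3 : (c3 : ℚ) = c4 * (r + s + 6) / (r + 1) := by
    rw [eq_div_iff (by positivity)]; exact_mod_cast r3
  have qr2 : (c2 : ℚ) = c3 * (r + s + 5) / (r + 2) := by
    rw [eq_div_iff (by positivity)]; exact_mod_cast r2
  have qr1 : (c1 : ℚ) = c2 * (r + s + 4) / (r + 3) := by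
    rw [eq_div_iff (by positivity)]; exact_mod_cast r1
  have qr0 : (c0 : ℚ) = c1 * (r + s + 3) / (r + 4) := by
    rw [eq_div_iff (by positivity)]; exact_mod_cast r0
  have qc4 : (0 : ℚ) < c4 := by exact_mod_cast hc4pos
  have hcoef : (0 : ℚ) ≤ 64 * (c4 + 4 * c3 + 6 * c2 + 4 * c1 + c0) - 16 * (37 * c3 + 19 * c2 + 6 * c1) := by
    rw [lower_coef_key r s c0 c1 c2 c3 c4 qr3 qr2 qr1 qr0]
    positivity
  have hH : (0 : ℚ) ≤ c3 * (64 * (c4 + 4 * c3 + 6 * c2 + 4 * c1 + c0) - 16 * (37 * c3 + 19 * c2 + 6 * c1))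
      + (63 * c0 + 19 * c1 - 19 * c2 - 63 * c3) * (c4 + 4 * c3 + 6 * c2 + 4 * c1 + c0)
      - (14 * c0 + 6 * c1 - 6 * c2 - 14 * c3) * (37 * c3 + 19 * c2 + 6 * c1) := by
    rw [lower_rest_key r s c0 c1 c2 c3 c4 qr3 qr2 qr1 qr0]
    positivity
  push_cast
  rw [← qAE, ← qBD]
  have qB : (B : ℚ) = A + c0 - c3 := by linarith
  have qC : (Cc : ℚ) = A + c0 - c3 + c1 - c2 := by linarith
  rw [qB, qC]
  exact lower_final A c0 c1 c2 c3 c4 qA3 hcoef hH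

end PercRepro.LineLadder
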